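import Summits.Ventures.PercRepro.S4MidKeyBaseSum
import Summits.Ventures.PercRepro.RankLevelSetLevelTenInfraGXT

/-!
# PercRepro — THE MIDDLE KEY AT LEVEL `11`, RANK `35` — PART 9 OF 9 (sizes `1278 … 1279`; p1 g48, S4 feeder — p9 owns SUBCLAIM-S4; no window claim here)

Part of the middle key at rank `35`, level `11` (n₀ = 1334, 8 layers; p1 g48): the certificate of proofs/P1-HYPKEY.md §16–§18 split DIAGONALLY —
the rows of every layer grouped by size into windows, the two big sums of the key (`#U ≤ Σ_k m[k,q]`, the `Y`-rows) split into unexpanded chunk sums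
that each window's part expands locally — so that every `linear_combination` stays under the gate's 600-second verification limit (§16 (e)).
Nothing is claimed below `n₀`. Axioms: standard.
-/

open scoped Matroid

namespace PercRepro

namespace S4Mid

open Set Finset S2LP S3Mid

variable {α : Type}

set_option maxHeartbeats 64000000 in
set_option maxRecDepth 20000 in
set_option linter.unusedSimpArgs false in
/-- Part `9` of the middle key at rank `35`, level `11`: the net form of the certificate's rows of sizes `1278 … 1279` (all layers) with the chunk sums of that window. -/
theorem c025_core_eleven_midkey_thirtyfive_p9 (M : Matroid α) [M.Finite] (hn : 1334 ≤ M.E.ncard)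
    (hfree : ∀ e ∈ M.E, ∃ A ⊆ M.E \ {e}, e ∉ M.closure A ∧ e ∉ M.closure ((M.E \ {e}) \ A)) :
    (269546135 / 51129) * ∑ i ∈ Finset.range 2, ((S1.rkSets M (11 + (1267 + i)) 11).ncard : ℚ) + (-43222169 / 8192) * ((S1.rkSets M 1278 11).ncard : ℚ) ≤ 0 := by
  classical
  have P := S1.pairs_of_free M hfree
  have L := S1.lines_of_free M hfree
  have Q := S1.planes_of_free M hfree
  have R := S1.tens_of_free M hfree
  have S : ∀ X ⊆ M.E, M.eRk X ≤ 5 → X.ncard ≤ 19 :=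
    fun X hX h => ThmN.ncard_le_nineteen_of_eRk_le_five_of_free M hfree hX h
  have h1279 : ∀ X ⊆ M.E, M.eRk X ≤ ((11 : ℕ) : ℕ∞) → X.ncard ≤ 1279 := fun X hX h => by
    have := ThmN.ncard_le_two_mul_add_one_of_free M hfree (k := 10) (B := 639) (fun _ hY hrY => ThmN.ncard_le_six_thirty_nine_of_eRk_le_ten_of_free M hfree _ hY (by exact_mod_cast hrY)) X hX (by exact_mod_cast h)
    omega
  have E2 : 2 ≤ M.E.ncard := by omega
  have C : ∀ {b F : ℕ} (hflat : ∀ X ⊆ M.E, M.eRk X ≤ (b : ℕ∞) → X.ncard ≤ F) (k : ℕ) (hbk : b ≤ k := by decide), (k - b + 1 + rminL (k - b + 1)) * (S1.rkSets M (k + 1) b).ncard ≤ (F - k) * (S1.rkSets M k b).ncard := fun hflat k hbk => cl_inst_flat_any P L Q R S E2 hflat k hbk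
  have c1278_11 := C h1279 1278
  have e11_9 : ∑ i ∈ Finset.range 2, (S1.rkSets M (11 + (1267 + i)) 11).ncard = (S1.rkSets M 1278 11).ncard + (S1.rkSets M 1279 11).ncard := by simp only [Finset.sum_range_succ, Finset.sum_range_zero, Nat.reduceAdd, zero_add, add_zero]
  simp only [rminL, Finset.sum_range_succ, Finset.sum_range_zero, Nat.reduceAdd, Nat.reduceSub, Nat.reduceMul, Nat.reduceEqDiff, Nat.reduceLeDiff, ↓reduceIte, zero_add, add_zero, zero_mul, mul_zero, one_mul, mul_one, Nat.add_sub_cancel] at c1278_11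
  qify at c1278_11 e11_9
  have hn0 : ∀ s : Set (Set α), (0 : ℚ) ≤ (s.ncard : ℚ) := fun s => Nat.cast_nonneg _
  have N : ∀ k r : ℕ, (0 : ℚ) ≤ ((S1.rkSets M k r).ncard : ℚ) := fun k r => hn0 _
  linear_combination ((67799 / 16384 * c1278_11 + 269546135 / 51129 * e11_9) + (102186691 / 837697536 * N 1278 11 + 35422307 / 418848768 * N 1279 11))

end S4Mid

end PercRepro
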